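import Summits.AtomisticToContinuum.FouriersLaw.Theorems.JunctionLocalityNonBallisticOfConeScaleCorrector

/-!
# A sub-cubic Kubo corrector along a subsequence already gives `NonBallistic` (stmt-AtomisticToContinuum-9127)

Helper file (`--supports stmt-AtomisticToContinuum-9127`), sharpening the edge
`nonBallistic_of_coneScaleCorrector` (`Theorems/JunctionLocalityNonBallisticOfConeScaleCorrector.lean`): the crux
`JunctionLocality.NonBallistic` needs much LESS than the cone-scale bound `‖u_N‖² ≤ C N² Z` of crux E1
(`ConeScaleCorrector`, stmt-AtomisticToContinuum-14069). It suffices that the Kubo corrector of the total current is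
SUB-CUBIC along a subsequence of lengths,

  `SubcubicCorrector`: `∀ ε > 0, ∀ N₀, ∃ N ≥ N₀, ∀ u` (a.e.-limit of the finite-horizon correctors `∫₀^τ P_t J_tot dt`
  of the equilibrium open chain), `u ∈ L²(μ_T)` and `∫ u² dμ_T ≤ ε · N³ · Z`

(`μ_T = e^{-H_N/T} dq dp`, `Z` its mass) — the hypothesis of `nonBallistic_of_subcubicCorrector` (a registered sub-goal
of the item, written INLINE: no `def` in a proof file), stated in the exact vocabulary of `ConeScaleCorrector` / `CorrectorTheory`. The harmonic (ballistic) member has `‖u_N‖² ≍ N³` exactly, so this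
is the minimal corrector-size input: any sub-ballistic saving in the corrector norm closes the crux. Proof: corrector-form
Green–Kubo `(N-1)T²D_N Z = ⟨u, J_tot⟩_{μ_T}` (PROVED `CorrectorTheory` B + the landed pairing lemma), the `N`-uniform
statics `‖J_tot‖² ≤ C_J N Z` (`NonBallistic.exists_totalCurrent_sq_le`) and AM–GM with the `N`-dependent weight
`θ = α/N`, `α = 4 max(C_J,1)/(εT²)`, fed with the stub at tolerance `ε' = ε²T⁴/(16 max(C_J,1))`.
`nonBallistic_of_subcubicCorrector : SubcubicCorrector → NonBallistic`; and E1 implies the hypothesis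
(`subcubicCorrector_of_coneScaleCorrector`), so `nonBallistic_of_coneScaleCorrector` factors through it. OPEN: the
hypothesis carries the anharmonic, `N`-uniform content (FALSE for the harmonic member). No definitions; nothing here closes
an item.
-/

noncomputable section

open MeasureTheory Filter Topology Set
open scoped BigOperators ENNReal

namespace Summit.AtomisticToContinuum.FouriersLaw.Theorems.NonBallistic

open Literature.MathematicalPhysics.KineticTheory.HeatConduction
open Summit.AtomisticToContinuum.FouriersLaw.Theses.OddSectorIrreversibility (ConeScaleCorrector)
open Summit.AtomisticToContinuum.FouriersLaw.Theses.JunctionLocality (NonBallistic)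

/-- **E1 ⟹ SubcubicCorrector**: `ConeScaleCorrector` (`‖u_N‖² ≤ C N² Z` for all `N`) gives the sub-cubic corrector
bound `∫ u² dμ_T ≤ ε N³ Z` beyond every `N₀` (take `N ≥ max(N₀, 1, C/ε)`). [folklore] -/
theorem subcubicCorrector_of_coneScaleCorrector :
    Summit.AtomisticToContinuum.FouriersLaw.Theses.OddSectorIrreversibility.ConeScaleCorrector →
    (∀ ω₂ lam β γ : ℝ, 0 < ω₂ → 0 < lam → 0 < β → 0 < γ → ∀ T : ℝ, 0 < T → ∀ ε : ℝ, 0 < ε → ∀ N₀ : ℕ,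
      ∃ N : ℕ, N₀ ≤ N ∧ ∀ u : PhaseSpace N → ℝ,
        (∀ᵐ x ∂(volume.withDensity fun x : PhaseSpace N =>
            ENNReal.ofReal (Real.exp (-((pinnedChain ω₂ lam β γ).hamiltonian N x) / T))),
          Tendsto (fun τ : ℝ => ∫ t in Ioc (0 : ℝ) τ,
            (∫ y, (∑ i : Fin N, (pinnedChain ω₂ lam β γ).bondCurrent N i y)
              ∂((pinnedChain ω₂ lam β γ).transitionKernel N T T t.toNNReal x))) atTop (𝓝 (u x))) →
        MemLp u 2 (volume.withDensity fun x : PhaseSpace N =>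
            ENNReal.ofReal (Real.exp (-((pinnedChain ω₂ lam β γ).hamiltonian N x) / T))) ∧
          ∫ x, (u x) ^ 2 ∂(volume.withDensity fun x : PhaseSpace N =>
              ENNReal.ofReal (Real.exp (-((pinnedChain ω₂ lam β γ).hamiltonian N x) / T))) ≤
            ε * (N : ℝ) ^ 3 * ∫ x : PhaseSpace N, Real.exp (-((pinnedChain ω₂ lam β γ).hamiltonian N x) / T)) := by
  intro hE1 ω₂ lam β γ hω hl hβ hγ T hT ε hε N₀
  obtain ⟨C, hC⟩ := hE1 ω₂ lam β γ hω hl hβ hγ T hT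
  obtain ⟨M, hM⟩ := exists_nat_ge (max C 0 / ε)
  -- at every length `N ≥ max(1, M)` the cone-scale bound is below `ε N³ Z`
  have key : ∀ N : ℕ, 1 ≤ N → M ≤ N → ∀ u : PhaseSpace N → ℝ,
      (∀ᵐ x ∂(volume.withDensity fun x : PhaseSpace N =>
          ENNReal.ofReal (Real.exp (-((pinnedChain ω₂ lam β γ).hamiltonian N x) / T))),
        Tendsto (fun τ : ℝ => ∫ t in Ioc (0 : ℝ) τ,
          (∫ y, (∑ i : Fin N, (pinnedChain ω₂ lam β γ).bondCurrent N i y)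
            ∂((pinnedChain ω₂ lam β γ).transitionKernel N T T t.toNNReal x))) atTop (𝓝 (u x))) →
      MemLp u 2 (volume.withDensity fun x : PhaseSpace N =>
          ENNReal.ofReal (Real.exp (-((pinnedChain ω₂ lam β γ).hamiltonian N x) / T))) ∧
        ∫ x, (u x) ^ 2 ∂(volume.withDensity fun x : PhaseSpace N =>
            ENNReal.ofReal (Real.exp (-((pinnedChain ω₂ lam β γ).hamiltonian N x) / T))) ≤
          ε * (N : ℝ) ^ 3 * ∫ x : PhaseSpace N, Real.exp (-((pinnedChain ω₂ lam β γ).hamiltonian N x) / T) := by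
    intro N hN1 hNM u hu
    have h := hC N u
    simp only [] at h
    obtain ⟨hmem, hle⟩ := h hu
    refine ⟨hmem, hle.trans ?_⟩
    have hZ : 0 ≤ ∫ x : PhaseSpace N, Real.exp (-((pinnedChain ω₂ lam β γ).hamiltonian N x) / T) :=
      integral_nonneg fun _ => (Real.exp_pos _).le
    have hN1' : (1 : ℝ) ≤ (N : ℝ) := by exact_mod_cast hN1
    have hNM' : (M : ℝ) ≤ (N : ℝ) := by exact_mod_cast hNM
    have hCεN : max C 0 ≤ ε * (N : ℝ) := by
      have h1 : max C 0 / ε ≤ (N : ℝ) := hM.trans hNM'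
      rw [div_le_iff₀ hε] at h1
      linarith [mul_comm (N : ℝ) ε]
    refine mul_le_mul_of_nonneg_right ?_ hZ
    calc C * (N : ℝ) ^ 2 ≤ max C 0 * (N : ℝ) ^ 2 := mul_le_mul_of_nonneg_right (le_max_left _ _) (sq_nonneg _)
      _ ≤ ε * (N : ℝ) * (N : ℝ) ^ 2 := mul_le_mul_of_nonneg_right hCεN (sq_nonneg _)
      _ = ε * (N : ℝ) ^ 3 := by ring
  exact ⟨max (max N₀ 1) M, le_trans (le_max_left _ _) (le_max_left _ _),
    key _ (le_trans (le_max_right _ _) (le_max_left _ _)) (le_max_right _ _)⟩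

/-- **`SubcubicCorrector → NonBallistic`** (registered sub-goal `nonBallistic_of_subcubicCorrector`): a sub-cubic Kubo corrector along a subsequence of lengths gives the
non-ballistic conclusion of `JunctionLocality.NonBallistic` (stmt-AtomisticToContinuum-9127). With `C_J` the `N`-uniform
static constant (`‖J_tot‖² ≤ C_J N Z`, enlarged to `≥ 1`), `α = 4C_J/(εT²)` and the stub at tolerance
`ε' = ε²T⁴/(16 C_J)` beyond `max(N₀, 2)`: at the length `N` it returns, corrector-form Green–Kubo and AM–GM with weight
`θ = α/N` give `(N-1)T²D_N ≤ (α/(2N)) ε'N³ + (N/(2α)) C_J N ≤ εT²(N-1)²/2 + εT²(N-1)²/2`. [folklore] -/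
theorem nonBallistic_of_subcubicCorrector :
    (∀ ω₂ lam β γ : ℝ, 0 < ω₂ → 0 < lam → 0 < β → 0 < γ → ∀ T : ℝ, 0 < T → ∀ ε : ℝ, 0 < ε → ∀ N₀ : ℕ,
      ∃ N : ℕ, N₀ ≤ N ∧ ∀ u : PhaseSpace N → ℝ,
        (∀ᵐ x ∂(volume.withDensity fun x : PhaseSpace N =>
            ENNReal.ofReal (Real.exp (-((pinnedChain ω₂ lam β γ).hamiltonian N x) / T))),
          Tendsto (fun τ : ℝ => ∫ t in Ioc (0 : ℝ) τ,
            (∫ y, (∑ i : Fin N, (pinnedChain ω₂ lam β γ).bondCurrent N i y)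
              ∂((pinnedChain ω₂ lam β γ).transitionKernel N T T t.toNNReal x))) atTop (𝓝 (u x))) →
        MemLp u 2 (volume.withDensity fun x : PhaseSpace N =>
            ENNReal.ofReal (Real.exp (-((pinnedChain ω₂ lam β γ).hamiltonian N x) / T))) ∧
          ∫ x, (u x) ^ 2 ∂(volume.withDensity fun x : PhaseSpace N =>
              ENNReal.ofReal (Real.exp (-((pinnedChain ω₂ lam β γ).hamiltonian N x) / T))) ≤
            ε * (N : ℝ) ^ 3 * ∫ x : PhaseSpace N, Real.exp (-((pinnedChain ω₂ lam β γ).hamiltonian N x) / T)) →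
      Summit.AtomisticToContinuum.FouriersLaw.Theses.JunctionLocality.NonBallistic := by
  intro hS ω₂ lam β γ hω hl hβ hγ huniq μ hμ T hT D hD ε hε N₀
  obtain ⟨CJ₀, hCJ₀, hJ⟩ := exists_totalCurrent_sq_le hω hl.le hβ.le γ hT
  have hCT := Summit.AtomisticToContinuum.FouriersLaw.Theorems.OddSectorIrreversibility.Corrector.CorrectorTheory_proof
  -- constants
  have hT2 : 0 < T ^ 2 := by positivity
  set CJ : ℝ := max CJ₀ 1 with hCJdef
  have hCJ1 : 1 ≤ CJ := le_max_right _ _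
  have hCJ0 : 0 < CJ := lt_of_lt_of_le one_pos hCJ1
  have hCJle : CJ₀ ≤ CJ := le_max_left _ _
  set α : ℝ := 4 * CJ / (ε * T ^ 2) with hαdef
  have hα : 0 < α := by positivity
  set ε' : ℝ := ε ^ 2 * T ^ 4 / (16 * CJ) with hε'def
  have hε' : 0 < ε' := by positivity
  -- the stub beyond `max N₀ 2`
  obtain ⟨N, hNge, hSN⟩ := hS ω₂ lam β γ hω hl hβ hγ T hT ε' hε' (max N₀ 2)
  have hNN₀ : N₀ ≤ N := le_trans (le_max_left _ _) hNge
  have hN2 : 2 ≤ N := le_trans (le_max_right _ _) hNge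
  have hNpos : 0 < N := by omega
  refine ⟨N, hNN₀, ?_⟩
  set P := pinnedChain ω₂ lam β γ with hP
  set n : ℝ := (N : ℝ) with hndef
  have hn2 : (2 : ℝ) ≤ n := by rw [hndef]; exact_mod_cast hN2
  have hn0 : 0 < n := by linarith
  have hn1 : 0 < n - 1 := by linarith
  set θ : ℝ := α / n with hθdef
  have hθ : 0 < θ := by positivity
  -- the corrector at `N` (CorrectorTheory A) and the Green–Kubo identity (CorrectorTheory B)
  obtain ⟨u, hu1, hu2, hu3, hu4, h5, h6, h7⟩ := hCT.1 ω₂ lam β γ hω hl hβ hγ T hT N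
  obtain ⟨hcI, hGKB⟩ := hCT.2 ω₂ lam β γ hω hl hβ hγ huniq μ hμ T hT N (D N) (hD N)
  simp only [] at hu1 hu2 hu3 hu4 h5 h6 h7 hcI hGKB
  clear h5 h6 h7 hu1
  have hpair := Summit.AtomisticToContinuum.FouriersLaw.Theorems.pinnedChain_integral_corrector_mul_withDensity
    hω hl.le hβ hγ hNpos hT hu2 hu4 hcI
  set μT : Measure (PhaseSpace N) := volume.withDensity fun x : PhaseSpace N =>
    ENNReal.ofReal (Real.exp (-(P.hamiltonian N x) / T)) with hμT
  set Z : ℝ := ∫ x : PhaseSpace N, Real.exp (-(P.hamiltonian N x) / T) with hZdef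
  set J : PhaseSpace N → ℝ := fun x => ∑ i : Fin N, P.bondCurrent N i x with hJdef
  have hZ : 0 < Z := integral_exp_pos (pinnedChain_integrable_gibbsDensity hω hl.le hβ.le γ N hT)
  -- `⟨u, J⟩_{μ_T} = Z (N-1) T² D_N`
  have hGK : ∫ x, u x * J x ∂μT = Z * ((n - 1) * T ^ 2 * D N) := by
    rw [hGKB]; exact hpair.2
  -- the stub at this `N` and this `u`
  have hS' : ∫ x, (u x) ^ 2 ∂μT ≤ ε' * n ^ 3 * Z := (hSN u hu3).2
  -- the static bound at this `N`
  have hJ' : ∫ x, (J x) ^ 2 ∂μT ≤ CJ * n * Z := by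
    refine (hJ N).trans ?_
    exact mul_le_mul_of_nonneg_right (mul_le_mul_of_nonneg_right hCJle hn0.le) hZ.le
  -- integrability
  have huJ : Integrable (fun x => u x * J x) μT := hpair.1
  have hu2i : Integrable (fun x => (u x) ^ 2) μT := hu2.integrable_sq
  have hJ2i : Integrable (fun x => (J x) ^ 2) μT := by
    have hsm := Summit.AtomisticToContinuum.FouriersLaw.Theorems.pinnedChain_withDensity_eq_smul_gibbsMeasure
      (γ := γ) (N := N) hω hl.le hT hβ.le
    have hZt : P.partitionFunction N T ≠ ⊤ :=
      P.partitionFunction_ne_top (pinnedChain_integrable_gibbsDensity hω hl.le hβ.le γ N hT)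
    have hπ := (Summit.AtomisticToContinuum.FouriersLaw.Theorems.pinnedChain_sq_act_sum_bondCurrent
      hω hl.le hβ hγ hNpos hT 0).1
    rw [hμT, hsm]
    exact hπ.smul_measure hZt
  -- AM–GM under the integral
  have hamgm : ∫ x, u x * J x ∂μT ≤ θ / 2 * ∫ x, (u x) ^ 2 ∂μT + 1 / (2 * θ) * ∫ x, (J x) ^ 2 ∂μT := by
    have hgi : Integrable (fun x => θ / 2 * (u x) ^ 2 + 1 / (2 * θ) * (J x) ^ 2) μT :=
      (hu2i.const_mul (θ / 2)).add (hJ2i.const_mul (1 / (2 * θ)))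
    have hmono : ∫ x, u x * J x ∂μT ≤ ∫ x, (θ / 2 * (u x) ^ 2 + 1 / (2 * θ) * (J x) ^ 2) ∂μT :=
      integral_mono huJ hgi fun x => mul_le_weighted_amgm hθ (u x) (J x)
    have hsum : ∫ x, (θ / 2 * (u x) ^ 2 + 1 / (2 * θ) * (J x) ^ 2) ∂μT =
        θ / 2 * ∫ x, (u x) ^ 2 ∂μT + 1 / (2 * θ) * ∫ x, (J x) ^ 2 ∂μT := by
      rw [integral_add (hu2i.const_mul _) (hJ2i.const_mul _), integral_const_mul, integral_const_mul]
    exact hmono.trans_eq hsum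
  -- combine and divide by `Z`
  have hmain : (n - 1) * T ^ 2 * D N ≤ θ / 2 * (ε' * n ^ 3) + 1 / (2 * θ) * (CJ * n) := by
    have h1 : Z * ((n - 1) * T ^ 2 * D N) ≤ Z * (θ / 2 * (ε' * n ^ 3) + 1 / (2 * θ) * (CJ * n)) := by
      calc Z * ((n - 1) * T ^ 2 * D N) = ∫ x, u x * J x ∂μT := hGK.symm
        _ ≤ θ / 2 * ∫ x, (u x) ^ 2 ∂μT + 1 / (2 * θ) * ∫ x, (J x) ^ 2 ∂μT := hamgm
        _ ≤ θ / 2 * (ε' * n ^ 3 * Z) + 1 / (2 * θ) * (CJ * n * Z) := by gcongr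
        _ = Z * (θ / 2 * (ε' * n ^ 3) + 1 / (2 * θ) * (CJ * n)) := by ring
    exact le_of_mul_le_mul_left h1 hZ
  -- arithmetic: both terms are `ε T² n²/8 ≤ ε T² (n-1)²/2`
  have hterm1 : θ / 2 * (ε' * n ^ 3) = ε * T ^ 2 * n ^ 2 / 8 := by
    rw [hθdef, hαdef, hε'def]
    field_simp
    ring
  have hterm2 : 1 / (2 * θ) * (CJ * n) = ε * T ^ 2 * n ^ 2 / 8 := by
    rw [hθdef, hαdef]
    field_simp
    ring
  have hnsq : n ^ 2 ≤ 4 * (n - 1) ^ 2 := by nlinarith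
  have hA : ε * T ^ 2 * n ^ 2 / 8 ≤ ε * T ^ 2 * (n - 1) ^ 2 / 2 := by
    have : 0 ≤ ε * T ^ 2 := by positivity
    nlinarith
  have hfin : (n - 1) * T ^ 2 * D N ≤ (n - 1) * T ^ 2 * (ε * (n - 1)) := by
    calc (n - 1) * T ^ 2 * D N ≤ θ / 2 * (ε' * n ^ 3) + 1 / (2 * θ) * (CJ * n) := hmain
      _ ≤ ε * T ^ 2 * (n - 1) ^ 2 / 2 + ε * T ^ 2 * (n - 1) ^ 2 / 2 := by
          rw [hterm1, hterm2]; exact add_le_add hA hA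
      _ = (n - 1) * T ^ 2 * (ε * (n - 1)) := by ring
  have hpos : 0 < (n - 1) * T ^ 2 := by positivity
  exact le_of_mul_le_mul_left hfin hpos

/-- The edge through the weaker hypothesis: `ConeScaleCorrector → NonBallistic` factors as
`ConeScaleCorrector → SubcubicCorrector → NonBallistic`. [folklore] -/
theorem nonBallistic_of_coneScaleCorrector' (hE1 : ConeScaleCorrector) :
    Summit.AtomisticToContinuum.FouriersLaw.Theses.JunctionLocality.NonBallistic :=
  nonBallistic_of_subcubicCorrector (subcubicCorrector_of_coneScaleCorrector hE1)

end Summit.AtomisticToContinuum.FouriersLaw.Theorems.NonBallistic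

end
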